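import Mathlib
import HarnessLib
import HarnessLib.Audit
import Summits.CriticalPhenomena.PercolationContinuityZ3.Theorems.PercNearOneGluingNoHeavyLowerTailHexMSMatchBlockers

/-!
# Conjecture (MATCH), two dead classes: blocked pairs are cornerless; the corner property excludes blockers (hp-7 gen 69)

Support file for crux `stmt-CriticalPhenomena-4575` (route `PercNearOneGluingNoHeavy`), hull-port seat `prim-hp-7` (generation 69);
`--supports stmt-CriticalPhenomena-4575`.  No `sorry`.  Memo: `run/shared/lean/prim/prim-hp-7/FROM-prim-hp-7-g69-MATCH-SYMMETRIC.md` §0 (TS).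

Setting of `…HexMSMatchBlockers`: dead `p, q` with `x q = x p + 1`; the pair is BLOCKED if `p \ q ∈ 𝒟` or `q \ p ∈ 𝒟`.

* `inter_mem_symGen_of_blocked`, `union_mem_symGen_of_blocked` — **the corners of a blocked pair are generated**: `p ∩ q` is the far meet of `p`
  (resp. `q`) with the complement of the blocker, and `p ∪ q` the far join of `q` (resp. `p`) with the blocker; so neither corner is dead
  (`inter_not_dead_of_blocked`, `union_not_dead_of_blocked`) and in particular neither lies in a family of dead members.
* `not_blocked_of_corner_mem` — **corner property ⟹ no blocker**: if a family `F` of dead members contains, for the pair `(p, q)`, one of its corners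
  `p ∩ q`, `p ∪ q`, then `(p, q)` is not blocked.  Gen 69's data: every Δ-MS-TIGHT dead two-class family (`#cl(F \\ F) = 2 #F`) has the corner
  property for all its crossing pairs (exhaustive on `2^[4]`, 7·10⁵ tight families on `2^[5]`; conjecturally a property of EQUALITY in Marica–Schönheim:
  memo (TS3-MS), exact for n ≤ 4 over all 65 535 families), hence no blockers and Hall's condition for `cl F` with equality — the tight case of the
  two-class conjecture V-b.  The equality statement itself is not proved here.
-/

namespace Summit.CriticalPhenomena.PercolationContinuityZ3.Theorems

namespace GeneratedDonors

open Finset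

variable {α : Type*} [DecidableEq α]
variable {U : Finset α} {𝒟 : Finset (Finset α)} {x : Finset α → ZMod 6}

section Corners

/-- **The meet of a blocked pair is generated.**  If `p, q ∈ 𝒟` are dead with `x q = x p + 1` and `p \ q ∈ 𝒟` or `q \ p ∈ 𝒟`, then
`p ∩ q ∈ symGen U 𝒟 x`. -/
theorem inter_mem_symGen_of_blocked (hU : ∀ a ∈ 𝒟, a ⊆ U) (hco : ∀ a ∈ 𝒟, U \ a ∈ 𝒟)
    (hanti : ∀ a ∈ 𝒟, x (U \ a) = x a + 3) {p q : Finset α} (hp : p ∈ dead U 𝒟 x) (hq : q ∈ dead U 𝒟 x)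
    (hlab : x q = x p + 1) (hblk : p \ q ∈ 𝒟 ∨ q \ p ∈ 𝒟) : p ∩ q ∈ symGen U 𝒟 x := by
  by_cases hmem : p ∩ q ∈ 𝒟
  · -- a member below the dead p... is generated anyway: use the candidate lemmas' witnesses via farProducts ⊆ symGen
    rcases hblk with h | h
    · have hpD : p ∈ 𝒟 := (mem_filter.mp hp).1
      have h8 : ∀ s : ZMod 6, s + 5 + 3 = s + 2 := by decide
      have hfar : ¬ Close (x p) (x (U \ (p \ q))) := by
        rw [hanti _ h, label_sdiff_of_dead_adjacent hU hco hanti hp hq hlab h, h8]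
        have key : ∀ s : ZMod 6, ¬ Close s (s + 2) := by decide
        exact key _
      have hset : p ∩ q = p ∩ (U \ (p \ q)) := by
        ext i
        simp only [mem_inter, mem_sdiff, not_and, not_not]
        constructor
        · intro ⟨hip, hiq⟩; exact ⟨hip, hU p hpD hip, fun _ => hiq⟩
        · intro ⟨hip, _, h'⟩; exact ⟨hip, h' hip⟩
      exact farProducts_subset_symGen hU hco hanti hpD (mem_farProducts.mpr ⟨U \ (p \ q), hco _ h, hfar, Or.inl hset⟩)
    · have hqD : q ∈ 𝒟 := (mem_filter.mp hq).1
      have h8 : ∀ s : ZMod 6, s + 2 + 3 = s + 5 := by decide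
      have hfar : ¬ Close (x q) (x (U \ (q \ p))) := by
        rw [hanti _ h, label_sdiff_of_dead_adjacent' hU hco hanti hp hq hlab h, h8, hlab]
        have key : ∀ s : ZMod 6, ¬ Close (s + 1) (s + 5) := by decide
        exact key _
      have hset : p ∩ q = q ∩ (U \ (q \ p)) := by
        ext i
        simp only [mem_inter, mem_sdiff, not_and, not_not]
        constructor
        · intro ⟨hip, hiq⟩; exact ⟨hiq, hU q hqD hiq, fun _ => hip⟩
        · intro ⟨hiq, _, h'⟩; exact ⟨h' hiq, hiq⟩
      exact farProducts_subset_symGen hU hco hanti hqD (mem_farProducts.mpr ⟨U \ (q \ p), hco _ h, hfar, Or.inl hset⟩)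
  · -- an absent corner is a candidate (…Blockers), candidates lie in symGen
    rcases hblk with h | h
    · have hc := inter_mem_candidates_of_sdiff_mem hU hco hanti hp hq hlab h hmem
      unfold candidates at hc
      exact farProducts_subset_symGen hU hco hanti (mem_filter.mp hp).1 (mem_sdiff.mp hc).1
    · have hc := inter_mem_candidates_of_sdiff_mem' hU hco hanti hp hq hlab h hmem
      unfold candidates at hc
      exact farProducts_subset_symGen hU hco hanti (mem_filter.mp hq).1 (mem_sdiff.mp hc).1

/-- **The join of a blocked pair is generated**: `p ∪ q = q ∪ (p \ q)` resp. `p ∪ (q \ p)` is a far join of two members. -/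
theorem union_mem_symGen_of_blocked (hU : ∀ a ∈ 𝒟, a ⊆ U) (hco : ∀ a ∈ 𝒟, U \ a ∈ 𝒟)
    (hanti : ∀ a ∈ 𝒟, x (U \ a) = x a + 3) {p q : Finset α} (hp : p ∈ dead U 𝒟 x) (hq : q ∈ dead U 𝒟 x)
    (hlab : x q = x p + 1) (hblk : p \ q ∈ 𝒟 ∨ q \ p ∈ 𝒟) : p ∪ q ∈ symGen U 𝒟 x := by
  have hpD : p ∈ 𝒟 := (mem_filter.mp hp).1
  have hqD : q ∈ 𝒟 := (mem_filter.mp hq).1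
  rcases hblk with h | h
  · have hfar : ¬ Close (x q) (x (p \ q)) := by
      rw [hlab, label_sdiff_of_dead_adjacent hU hco hanti hp hq hlab h]
      have key : ∀ s : ZMod 6, ¬ Close (s + 1) (s + 5) := by decide
      exact key _
    have := union_mem_symGen_of_not_close hU hco hanti hqD h hfar
    rwa [union_comm q (p \ q), sdiff_union_self_eq_union] at this
  · have hfar : ¬ Close (x p) (x (q \ p)) := by
      rw [label_sdiff_of_dead_adjacent' hU hco hanti hp hq hlab h]
      have key : ∀ s : ZMod 6, ¬ Close s (s + 2) := by decide
      exact key _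
    have := union_mem_symGen_of_not_close hU hco hanti hpD h hfar
    rwa [union_sdiff_self_eq_union] at this

/-- The meet of a blocked pair is not dead. -/
theorem inter_not_dead_of_blocked (hU : ∀ a ∈ 𝒟, a ⊆ U) (hco : ∀ a ∈ 𝒟, U \ a ∈ 𝒟)
    (hanti : ∀ a ∈ 𝒟, x (U \ a) = x a + 3) {p q : Finset α} (hp : p ∈ dead U 𝒟 x) (hq : q ∈ dead U 𝒟 x)
    (hlab : x q = x p + 1) (hblk : p \ q ∈ 𝒟 ∨ q \ p ∈ 𝒟) : p ∩ q ∉ dead U 𝒟 x := fun h =>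
  (mem_filter.mp h).2 (inter_mem_symGen_of_blocked hU hco hanti hp hq hlab hblk)

/-- The join of a blocked pair is not dead. -/
theorem union_not_dead_of_blocked (hU : ∀ a ∈ 𝒟, a ⊆ U) (hco : ∀ a ∈ 𝒟, U \ a ∈ 𝒟)
    (hanti : ∀ a ∈ 𝒟, x (U \ a) = x a + 3) {p q : Finset α} (hp : p ∈ dead U 𝒟 x) (hq : q ∈ dead U 𝒟 x)
    (hlab : x q = x p + 1) (hblk : p \ q ∈ 𝒟 ∨ q \ p ∈ 𝒟) : p ∪ q ∉ dead U 𝒟 x := fun h =>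
  (mem_filter.mp h).2 (union_mem_symGen_of_blocked hU hco hanti hp hq hlab hblk)

/-- **Corner property ⟹ no blocker.**  If a family `F` of dead members contains a corner (`p ∩ q` or `p ∪ q`) of the adjacent dead pair
`(p, q)`, then neither `p \ q` nor `q \ p` is a member of `𝒟`. -/
theorem not_blocked_of_corner_mem (hU : ∀ a ∈ 𝒟, a ⊆ U) (hco : ∀ a ∈ 𝒟, U \ a ∈ 𝒟)
    (hanti : ∀ a ∈ 𝒟, x (U \ a) = x a + 3) {F : Finset (Finset α)} (hF : F ⊆ dead U 𝒟 x)
    {p q : Finset α} (hp : p ∈ dead U 𝒟 x) (hq : q ∈ dead U 𝒟 x) (hlab : x q = x p + 1)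
    (hcorner : p ∩ q ∈ F ∨ p ∪ q ∈ F) : p \ q ∉ 𝒟 ∧ q \ p ∉ 𝒟 := by
  constructor
  · intro h
    rcases hcorner with hc | hc
    · exact inter_not_dead_of_blocked hU hco hanti hp hq hlab (Or.inl h) (hF hc)
    · exact union_not_dead_of_blocked hU hco hanti hp hq hlab (Or.inl h) (hF hc)
  · intro h
    rcases hcorner with hc | hc
    · exact inter_not_dead_of_blocked hU hco hanti hp hq hlab (Or.inr h) (hF hc)
    · exact union_not_dead_of_blocked hU hco hanti hp hq hlab (Or.inr h) (hF hc)

end Corners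

section TightCase

/-!
### The deadness half of 'tight ⟹ no blockers' (gen 69 memo §4)

By the structure of equality in Marica–Schönheim (verified exhaustively on `2^[4]`; presumably Aharoni–Holzman 1993) a Δ-MS-tight dead family
`F = P ⊔ Q` is a translated product `a ⊔ (I \ D₁) ⊔ D₂` of difference-closed families, and for a cornerless pair `(p, q)` with
`γ = p \ q` it contains a member `f₁` DISJOINT from `γ` together with `f₁ ∪ γ`.  The two lemmas below are the contradiction: a dead member of
label `x p` cannot be disjoint from the blocker, and a dead member of label `x q` disjoint from the blocker has `f ∪ γ` generated (so
`f ∪ γ` is not dead, in particular not in `F`).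
-/

variable {U : Finset α} {𝒟 : Finset (Finset α)} {x : Finset α → ZMod 6}

/-- A dead member with the label of `p` meets the blocker `p \ q` (labels `x p` and `x p + 5` are close). -/
theorem inter_blocker_nonempty_of_dead (hU : ∀ a ∈ 𝒟, a ⊆ U) (hco : ∀ a ∈ 𝒟, U \ a ∈ 𝒟)
    (hanti : ∀ a ∈ 𝒟, x (U \ a) = x a + 3) {p q f : Finset α} (hp : p ∈ dead U 𝒟 x) (hq : q ∈ dead U 𝒟 x)
    (hlab : x q = x p + 1) (hmem : p \ q ∈ 𝒟) (hf : f ∈ dead U 𝒟 x) (hxf : x f = x p) : (f ∩ (p \ q)).Nonempty := by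
  have key : ∀ s : ZMod 6, Close s (s + 5) := by decide
  refine inter_nonempty_of_dead_of_close hf hmem ?_
  rw [label_sdiff_of_dead_adjacent hU hco hanti hp hq hlab hmem, hxf]
  exact key _

/-- A dead member with the label of `q` that is disjoint from the blocker `γ = p \ q` has `f ∪ γ` generated (a far join), hence
`f ∪ γ` is not dead. -/
theorem union_blocker_not_dead_of_dead (hU : ∀ a ∈ 𝒟, a ⊆ U) (hco : ∀ a ∈ 𝒟, U \ a ∈ 𝒟)
    (hanti : ∀ a ∈ 𝒟, x (U \ a) = x a + 3) {p q f : Finset α} (hp : p ∈ dead U 𝒟 x) (hq : q ∈ dead U 𝒟 x)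
    (hlab : x q = x p + 1) (hmem : p \ q ∈ 𝒟) (hf : f ∈ dead U 𝒟 x) (hxf : x f = x q) :
    f ∪ (p \ q) ∉ dead U 𝒟 x := by
  intro h
  have key : ∀ s : ZMod 6, ¬ Close (s + 1) (s + 5) := by decide
  have hfar : ¬ Close (x f) (x (p \ q)) := by
    rw [label_sdiff_of_dead_adjacent hU hco hanti hp hq hlab hmem, hxf, hlab]
    exact key _
  exact (mem_filter.mp h).2 (union_mem_symGen_of_not_close hU hco hanti (mem_filter.mp hf).1 hmem hfar)

/-- Second kind, dually: a dead member with the label of `q` meets the blocker `q \ p` (labels `x p + 1`, `x p + 2` close). -/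
theorem inter_blocker_nonempty_of_dead' (hU : ∀ a ∈ 𝒟, a ⊆ U) (hco : ∀ a ∈ 𝒟, U \ a ∈ 𝒟)
    (hanti : ∀ a ∈ 𝒟, x (U \ a) = x a + 3) {p q f : Finset α} (hp : p ∈ dead U 𝒟 x) (hq : q ∈ dead U 𝒟 x)
    (hlab : x q = x p + 1) (hmem : q \ p ∈ 𝒟) (hf : f ∈ dead U 𝒟 x) (hxf : x f = x q) : (f ∩ (q \ p)).Nonempty := by
  have key : ∀ s : ZMod 6, Close (s + 1) (s + 2) := by decide
  refine inter_nonempty_of_dead_of_close hf hmem ?_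
  rw [label_sdiff_of_dead_adjacent' hU hco hanti hp hq hlab hmem, hxf, hlab]
  exact key _

/-- Second kind, dually: a dead member with the label of `p` disjoint from `γ' = q \ p` has `f ∪ γ'` generated. -/
theorem union_blocker_not_dead_of_dead' (hU : ∀ a ∈ 𝒟, a ⊆ U) (hco : ∀ a ∈ 𝒟, U \ a ∈ 𝒟)
    (hanti : ∀ a ∈ 𝒟, x (U \ a) = x a + 3) {p q f : Finset α} (hp : p ∈ dead U 𝒟 x) (hq : q ∈ dead U 𝒟 x)
    (hlab : x q = x p + 1) (hmem : q \ p ∈ 𝒟) (hf : f ∈ dead U 𝒟 x) (hxf : x f = x p) :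
    f ∪ (q \ p) ∉ dead U 𝒟 x := by
  intro h
  have key : ∀ s : ZMod 6, ¬ Close s (s + 2) := by decide
  have hfar : ¬ Close (x f) (x (q \ p)) := by
    rw [label_sdiff_of_dead_adjacent' hU hco hanti hp hq hlab hmem, hxf]
    exact key _
  exact (mem_filter.mp h).2 (union_mem_symGen_of_not_close hU hco hanti (mem_filter.mp hf).1 hmem hfar)

end TightCase

end GeneratedDonors

end Summit.CriticalPhenomena.PercolationContinuityZ3.Theorems
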